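import Literature.MathematicalPhysics.QuantumFieldTheory.Balaban1983to89.B13TermWalkDataOneTorus
import Literature.MathematicalPhysics.QuantumFieldTheory.Balaban1983to89.B13Sqrt27
import Summits.QuantumFields.BalabanUV.T4Continuum.Spine.NE5.TwoRunPrimitivePencil

/-!
# Spine/NE5/TwoRunTorusWalkRePos — `Re A(σ,u) ≻ 0` of the precision FROM THE WALK RECORD: NODE A's positivity input
# along the pencil ∕ seam is symmetry + one smallness (cell `pub-balaban-gaps`, seat `ne5` gen 9)

WHY.  The walk-record junction (T25 `TwoRunTorusWalkParam.hol_and_h226_torus_of_termWalkData_param`, T26, T27) and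
g1-p2's capstone `B13TermWalkData.differences216_of_termWalkData` take, per term and configuration, NODE A's two inputs
`hAs` (the precision `A(σ,u)` is symmetric) and `hA` (`Re A(σ,u) ≻ 0`) on the closed polydisc × the closed `α`-ball
([II] p. 15: *"for (U, 0) the operators are symmetric, and the measure is positive"* — printed at the REFERENCE pair
only).  T22 `TwoRunPrimitivePencil.re_posDef_of_letter` showed along NE5's affine pencil that `Re A ≻ 0` is not an
extra input: an entrywise (2.16)-letter `‖A − C⁻¹‖_{bb′} ≤ θ_E e^{−κd}` against the real reference `C ≻ 0` with
`θ_E·m(1+2∕κ)^ν·λ_max(C) < 1` forces it.  THIS FILE does the same for ANY walk record: the precision's joint walk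
expansion (`TermWalkData.hE`: σ-structure through `X`, analyticity on the `R`-ball, majorants `K̄_E`) gives the letter
`‖A(σ,u) − A(0,0)‖_{bb′} ≤ (2K̄_Ee^{−εR_σ} + 2K̄_Eα∕R)·e^{−κd₁}` at every `‖u‖ ≤ α` WITHOUT any positivity input
(§1 `norm_A2_sub_ref_le_of_termWalkData` — the σ-part by `JointWalkExpansion.sub_ref_sigma`, the `u`-part by the
Schwarz step `B13PrimitiveKernels216.sub_ref_le_of_analytic`), the record's `A(0,0)⁻¹ = C`, `C ≻ 0` give
`A(0,0) = C⁻¹` (§1 `A2_zero_eq_of_record`), and T22's lemma concludes (§2 `re_posDef_of_termWalkData`):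
`Re A(σ,u) ≻ 0` on the closed polydisc × closed `α`-ball from {the record, SYMMETRY of `A(σ,u)`, `λ_max(C) ≤ c_E`,
`θ_E(w,α)·𝒦.m·(1+2∕w.κ)^ν·c_E < 1`}.  So in T25∕T26∕T27's residual list, item (ii) «symmetry ∕ Re ≻ 0 (NODE A)» shrinks
to SYMMETRY + one numeric in the record's letters; §3 `differences216_of_termWalkData_symm` is g1-p2's capstone with its
`hA` so discharged; §4 discharges the spectral letter `hc : λ_k(C) ≤ c_E` too (`eigenvalues_le_of_termWalkData`:
`λ_max(C) ≤ K̄_C·𝒦.m·(1+2∕w.κ)^ν` from L17a's `hC216` by a Rayleigh∕Schur bound), so `re_posDef_of_termWalkData'` needs the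
record, symmetry and ONE smallness in the record's letters only; §5 discharges the Γ₀-form letter `g`
(`gammaForm_le_of_termWalkData`: `⟨Γ₀X, CΓ₀X⟩ ≤ g‖X‖²` by §4 and a Schur bound on L17a's `hΓ₀`).  Independent of T21 (imports g1-p2's `B13TermWalkDataOneTorus`, r10's `B13Sqrt27` and T22 only).

HONEST FRAMING.  Composition of LANDED shapes (g1-p2's walk records and projections, r10's located algebra via T22);
every record and number is a HYPOTHESIS; nothing of Bałaban's `C^{(k)}(Z₀,σ,𝐔,𝐉)` is constructed or asserted; whether his
precision admits such a record is NODE O's statement (v); NE5 NOT PRINTED ∕ NOT PROVED; leaves 0∕12; (D4) 0∕1; spine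
0∕9.  Rung (B)+1 on a FIXED finite T⁴ — NOT continuum, NOT infinite volume, NOT mass gap, NOT Clay.  0 sorry, 0 `def`.

Sources: [II] = T. Bałaban, CMP **116** (1988) [Balaban1988RG2Cluster] p. 13, p. 15, (2.16) p. 16, (2.24) p. 17;
[B9] = CMP **99** (1985) [Balaban1985BackgroundPropagators] Thm 3.10 p. 416.  Nothing here is a claim about the
Yang–Mills mass gap.
-/

noncomputable section

namespace Summit.QuantumFields.BalabanUV.T4Continuum.Spine.NE5.TwoRunTorusWalkRePos

open Matrix Metric Set Finset
open Literature.MathematicalPhysics.QuantumFieldTheory.Balaban1983to89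
open Literature.MathematicalPhysics.QuantumFieldTheory.Balaban1983to89.TreeLengthTorus (TPt)
open Literature.MathematicalPhysics.QuantumFieldTheory.Balaban1983to89.B5TorusCover (UT)
open Literature.MathematicalPhysics.QuantumFieldTheory.Balaban1983to89.B9Thm37GlueTorus (tdist1)
open Literature.MathematicalPhysics.QuantumFieldTheory.Balaban1983to89.B13Lemma3TorusPrimitive
  (weightHyp_tdist1 tdist1_symm kc_tdist1)
open Literature.MathematicalPhysics.QuantumFieldTheory.Balaban1983to89.B13PrimitiveKernels216
  (Differences216 sub_ref_le_of_analytic)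
open Literature.MathematicalPhysics.QuantumFieldTheory.Balaban1983to89.B13PerturbativeStep (WeightHyp)
open Literature.MathematicalPhysics.QuantumFieldTheory.Balaban1983to89.B13Bound226Located
  (WRS_zero_of_entrywise weightHyp_loc rowSum_norm_le_of_entrywise colSum_norm_le_of_entrywise)
open Literature.MathematicalPhysics.QuantumFieldTheory.Balaban1983to89.B13Replacement223
  (abs_quadForm_le_of_WRS abs_bilinForm_le)
open Literature.MathematicalPhysics.QuantumFieldTheory.Balaban1983to89.B13Integral223 (quadForm_le)
open Literature.MathematicalPhysics.QuantumFieldTheory.Balaban1983to89.B13Sqrt27 (eigenvalues_le_of_form_le)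
open Literature.MathematicalPhysics.QuantumFieldTheory.Balaban1983to89.B13TermWalkData (localisation17a_of_termWalkData)
open Literature.MathematicalPhysics.QuantumFieldTheory.Balaban1983to89.B13TermWalkData
  (WalkConsts TermKernels TermWalkData differences216_of_termWalkData)
open Summit.QuantumFields.BalabanUV.T4Continuum.Spine.NE5.TwoRunPrimitivePencil (re_posDef_of_letter)

variable {d N' : ℕ} {ν : ℕ} {Nf : Fin ν → ℕ} [∀ i, NeZero (Nf i)]
variable {B : Type*} [NormedAddCommGroup B] [NormedSpace ℂ B]
variable {c : B13.Consts}

/-! ## §1. The precision's (2.16)-letter against its reference value, from the walk record alone -/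

/-- **THE PRECISION's σ- AND u-DIFFERENCE FROM THE WALK RECORD, NO POSITIVITY INPUT**: for a record `𝒦` with walk
objects `TermWalkData 𝒦 w` (`w` admissible at size `α ≥ 0`), at every configuration `‖u‖ ≤ α` and every σ of the closed
polydisc `‖σ_j‖ ≤ e^{κ₁}`: `‖(A(σ,u) − A(0,0))_{bb′}‖ ≤ (2K̄_Ee^{−εR_σ} + 2K̄_Eα∕R)·e^{−κ·d₁(loc b, loc b′)}` — the σ-part
through `X` (`JointWalkExpansion.sub_ref_sigma`, rows `R_σ`-far from `X`) plus the `u`-part by the Schwarz step on the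
`R`-ball (`sub_ref_le_of_analytic` with `analyticOnBall`, `majorants`): print's `O(1)e^{−⅓δ₀M} + O(α₀ + α₁)`.
[cite: Balaban1988RG2Cluster, p.13, p.15, (2.16) p.16; Balaban1985BackgroundPropagators, Thm 3.10 p.416] -/
theorem norm_A2_sub_ref_le_of_termWalkData {𝒦 : TermKernels c d N' ν Nf B} {w : WalkConsts} {α Rσ₀ : ℝ}
    (hw : w.Admissible α Rσ₀) (hα : 0 ≤ α) (h : TermWalkData 𝒦 w) {u : B} (hu : ‖u‖ ≤ α)
    (σ : TPt d N' → ℂ) (hσ : ∀ j, ‖σ j‖ ≤ Real.exp c.κ₁) (b b' : 𝒦.Λ) :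
    ‖(𝒦.A2 σ u - 𝒦.A2 0 0) b b'‖ ≤
      (2 * w.KbarE * Real.exp (-(w.ε * w.Rσ)) + 2 * w.KbarE * α / w.R)
        * Real.exp (-(w.kap * tdist1 Nf (𝒦.locΛ b) (𝒦.locΛ b'))) := by
  obtain ⟨WE, TE, SXE, AE, DE, ρE, hEw⟩ := h.hE
  have hR : 0 < w.R := hα.trans_lt hw.hαR
  exact sub_ref_le_of_analytic (K := fun v => 𝒦.A2 σ v) (Kref := 𝒦.A2 0 0) hR hw.hKbarE hw.hαR
    (g := fun b b' => Real.exp (-(w.kap * tdist1 Nf (𝒦.locΛ b) (𝒦.locΛ b')))) (fun _ _ => (Real.exp_pos _).le)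
    (hEw.sub_ref_sigma hR hw.hε h.hfar σ hσ) (hEw.analyticOnBall hw.hε σ hσ) (hEw.majorants hw.hε σ hσ) hu b b'

/-- **The reference precision is the inverse reference covariance**: `A(0,0) = C⁻¹` from the record's
`A(0,0)⁻¹ = C` and `C ≻ 0` (the block of `B13PrimitiveKernels216Reduced.differences216_of_analytic_two`, isolated).
[cite: Balaban1988RG2Cluster, p.15] -/
theorem A2_zero_eq_of_record (𝒦 : TermKernels c d N' ν Nf B) : 𝒦.A2 0 0 = 𝒦.C⁻¹.map (algebraMap ℝ ℂ) := by
  have hCu : IsUnit 𝒦.C.det := 𝒦.hC.det_pos.ne'.isUnit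
  have hmul : 𝒦.C⁻¹.map (algebraMap ℝ ℂ) * 𝒦.C.map (algebraMap ℝ ℂ) = 1 := by
    rw [← Matrix.map_mul, Matrix.nonsing_inv_mul 𝒦.C hCu, Matrix.map_one _ (map_zero _) (map_one _)]
  have hCmu : IsUnit (𝒦.C.map (algebraMap ℝ ℂ)) :=
    (Matrix.isUnit_iff_isUnit_det _).2 (Matrix.isUnit_det_of_left_inverse hmul)
  have hAu : IsUnit (𝒦.A2 0 0).det := by
    rw [← Matrix.isUnit_iff_isUnit_det, ← Matrix.isUnit_nonsing_inv_iff, 𝒦.hC0]; exact hCmu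
  rw [← Matrix.nonsing_inv_nonsing_inv (𝒦.A2 0 0) hAu, 𝒦.hC0]
  exact Matrix.inv_eq_left_inv hmul

/-- §1 against the reference covariance: `‖(A(σ,u) − C⁻¹)_{bb′}‖ ≤ θ_E(w,α)·e^{−κd₁}` — the `hdE` field of
`Differences216` at rate `w.κ`, from the record alone. [cite: Balaban1988RG2Cluster, (2.16) p.16] -/
theorem norm_A2_sub_inv_ref_le_of_termWalkData {𝒦 : TermKernels c d N' ν Nf B} {w : WalkConsts} {α Rσ₀ : ℝ}
    (hw : w.Admissible α Rσ₀) (hα : 0 ≤ α) (h : TermWalkData 𝒦 w) {u : B} (hu : ‖u‖ ≤ α)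
    (σ : TPt d N' → ℂ) (hσ : ∀ j, ‖σ j‖ ≤ Real.exp c.κ₁) (b b' : 𝒦.Λ) :
    ‖(𝒦.A2 σ u - 𝒦.C⁻¹.map (algebraMap ℝ ℂ)) b b'‖ ≤
      (2 * w.KbarE * Real.exp (-(w.ε * w.Rσ)) + 2 * w.KbarE * α / w.R)
        * Real.exp (-(w.kap * tdist1 Nf (𝒦.locΛ b) (𝒦.locΛ b'))) := by
  rw [← A2_zero_eq_of_record 𝒦]
  exact norm_A2_sub_ref_le_of_termWalkData hw hα h hu σ hσ b b'

/-! ## §2. `Re A(σ,u) ≻ 0` from the record, symmetry and one smallness -/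

/-- **`Re A(σ,u) ≻ 0` FROM THE WALK RECORD** (NODE A's positivity input discharged to symmetry + a numeric): for a record
`𝒦` with `TermWalkData 𝒦 w`, `w.Admissible α Rσ₀`, `0 ≤ α`, at every configuration `‖u‖ ≤ α` and every σ of the closed
polydisc at which `A(σ,u)` is SYMMETRIC, if `λ_max(C) ≤ c_E` and `θ_E(w,α)·(𝒦.m·(1+2∕w.κ)^ν)·c_E < 1`
(`θ_E(w,α) = 2K̄_Ee^{−εR_σ} + 2K̄_Eα∕R`), then `Re A(σ,u) ≻ 0` — T22 `re_posDef_of_letter` on §1's letter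
(`Re A ≽ C⁻¹ − θ_E·m(1+2∕κ)^ν·1 ≻ 0`).  Feeds `hA` of T25∕T26∕T27 and of `differences216_of_termWalkData`.
[cite: Balaban1988RG2Cluster, p.15, (2.16) p.16, (2.24) p.17] -/
theorem re_posDef_of_termWalkData {𝒦 : TermKernels c d N' ν Nf B} {w : WalkConsts} {α Rσ₀ : ℝ}
    (hw : w.Admissible α Rσ₀) (hα : 0 ≤ α) (h : TermWalkData 𝒦 w) {u : B} (hu : ‖u‖ ≤ α)
    (σ : TPt d N' → ℂ) (hσ : ∀ j, ‖σ j‖ ≤ Real.exp c.κ₁) (hAs : (𝒦.A2 σ u).IsSymm)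
    {cE : ℝ} (hc : ∀ k, 𝒦.hC.1.eigenvalues k ≤ cE)
    (hsmall : (2 * w.KbarE * Real.exp (-(w.ε * w.Rσ)) + 2 * w.KbarE * α / w.R)
      * (𝒦.m * (1 + 2 / w.kap) ^ ν) * cE < 1) :
    ((𝒦.A2 σ u).map Complex.re).PosDef := by
  have hθE : 0 ≤ 2 * w.KbarE * Real.exp (-(w.ε * w.Rσ)) + 2 * w.KbarE * α / w.R := by
    have := hw.hKbarE; have := hα.trans_lt hw.hαR; positivity
  exact re_posDef_of_letter (weightHyp_tdist1 (N := Nf)) tdist1_symm kc_tdist1 𝒦.hC hAs hθE hw.hkap 𝒦.locΛ 𝒦.hfib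
    (norm_A2_sub_inv_ref_le_of_termWalkData hw hα h hu σ hσ) hc hsmall

/-- **Uniform form on the closed polydisc × closed ball** (the shape of T25's binder `hA` and of
`differences216_of_termWalkData`'s `hA`, given symmetry there). [cite: Balaban1988RG2Cluster, p.15, (2.16) p.16] -/
theorem re_posDef_on_ball_of_termWalkData {𝒦 : TermKernels c d N' ν Nf B} {w : WalkConsts} {α Rσ₀ : ℝ}
    (hw : w.Admissible α Rσ₀) (hα : 0 ≤ α) (h : TermWalkData 𝒦 w)
    (hAs : ∀ b : B, ‖b‖ ≤ α → ∀ σ : TPt d N' → ℂ, (∀ j, ‖σ j‖ ≤ Real.exp c.κ₁) → (𝒦.A2 σ b).IsSymm)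
    {cE : ℝ} (hc : ∀ k, 𝒦.hC.1.eigenvalues k ≤ cE)
    (hsmall : (2 * w.KbarE * Real.exp (-(w.ε * w.Rσ)) + 2 * w.KbarE * α / w.R)
      * (𝒦.m * (1 + 2 / w.kap) ^ ν) * cE < 1) :
    ∀ b : B, ‖b‖ ≤ α → ∀ σ : TPt d N' → ℂ, (∀ j, ‖σ j‖ ≤ Real.exp c.κ₁) →
      ((𝒦.A2 σ b).map Complex.re).PosDef :=
  fun b hb σ hσ => re_posDef_of_termWalkData hw hα h hb σ hσ (hAs b hb σ hσ) hc hsmall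

/-! ## §3. g1-p2's capstone without the positivity input -/

/-- **`Differences216` FROM THE RECORD AND SYMMETRY ALONE** (g1-p2's `differences216_of_termWalkData` with its `hA`
discharged by §2): record + admissible package + symmetry of `A(σ,u)` on the closed polydisc at the configuration
`‖u‖ ≤ α` + `λ_max(C) ≤ c_E` + `θ_E(w,α)·(𝒦.m·(1+2∕w.κ)^ν)·c_E < 1` ⟹ `Differences216` at any twice-dropped rate with the
capstone's letters. [cite: Balaban1988RG2Cluster, (2.16) p.16, p.15; Balaban1985BackgroundPropagators, Thm 3.10 p.416] -/
theorem differences216_of_termWalkData_symm {𝒦 : TermKernels c d N' ν Nf B} {w : WalkConsts} {α Rσ₀ : ℝ}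
    (hw : w.Admissible α Rσ₀) (hα : 0 ≤ α) (h : TermWalkData 𝒦 w)
    {kap' kap'' : ℝ} (hkap'' : 0 ≤ kap'') (h1 : kap'' < kap') (h2 : kap' < w.kap)
    {u : B} (hu : ‖u‖ ≤ α)
    (hAs : ∀ σ : TPt d N' → ℂ, (∀ j, ‖σ j‖ ≤ Real.exp c.κ₁) → (𝒦.A2 σ u).IsSymm)
    {cE : ℝ} (hc : ∀ k, 𝒦.hC.1.eigenvalues k ≤ cE)
    (hsmall : (2 * w.KbarE * Real.exp (-(w.ε * w.Rσ)) + 2 * w.KbarE * α / w.R)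
      * (𝒦.m * (1 + 2 / w.kap) ^ ν) * cE < 1) :
    Differences216 c (fun σ => 𝒦.A2 σ u) (fun σ => 𝒦.G2 σ u) 𝒦.Γ₀ 𝒦.C 𝒦.locΛ 𝒦.locN kap''
      (2 * w.KbarΓ * Real.exp (-(w.ε * w.Rσ)) + 2 * w.KbarΓ * α / w.R)
      (w.KbarC * (2 * w.KbarE * Real.exp (-(w.ε * w.Rσ)) + 2 * w.KbarE * α / w.R)
        * (𝒦.m * (1 + 2 / (w.kap - kap')) ^ ν) * w.KbarC * (𝒦.m * (1 + 2 / (kap' - kap'')) ^ ν))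
      (2 * w.KbarE * Real.exp (-(w.ε * w.Rσ)) + 2 * w.KbarE * α / w.R) :=
  differences216_of_termWalkData hw hα h hkap'' h1 h2 hu hAs
    fun σ hσ => re_posDef_of_termWalkData hw hα h hu σ hσ (hAs σ hσ) hc hsmall

/-! ## §4. The covariance's top eigenvalue from the record (`λ_max(C) ≤ K̄_C·m·(1+2∕κ)^ν`) -/

section Eigen

variable {S : Type*} [DecidableEq S] {ρd : S → S → ℝ} {Kc : ℝ → ℝ}
variable {Λ : Type} [Fintype Λ] [DecidableEq Λ]

/-- **Eigenvalues of a located real symmetric kernel with entrywise decay** (site space `S`, weight `ρ`, lattice constant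
`Kc`, `≤ m` indices per site): `‖C_{bb′}‖ ≤ K₀e^{−κρ(loc b, loc b′)}` ⟹ every eigenvalue `≤ K₀·m·Kc(κ)` — the Rayleigh
quotient through the Schur row∕column sums (`WRS_zero_of_entrywise` + `abs_quadForm_le_of_WRS` +
`B13Sqrt27.eigenvalues_le_of_form_le`).  Discharges the letter `hc : λ_k(C) ≤ c_E` of the (2.26) chain from L17a's `hC216`.
[cite: Balaban1988RG2Cluster, (2.16) p.16, (2.24) p.17] -/
theorem eigenvalues_le_of_located (hρ : WeightHyp 0 ρd) (hρs : ∀ x y : S, ρd x y = ρd y x)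
    (hKc : ∀ b : ℝ, 0 < b → ∀ (T : Finset S) (x : S), ∑ y ∈ T, Real.exp (-(b * ρd x y)) ≤ Kc b)
    {C : Matrix Λ Λ ℝ} (hC : C.IsHermitian) {K₀ κ : ℝ} (hK₀ : 0 ≤ K₀) (hκ : 0 < κ) (loc : Λ → S) {m : ℕ}
    (hfib : ∀ x : S, (Finset.univ.filter fun i => loc i = x).card ≤ m)
    (hC216 : ∀ b b', ‖C b b'‖ ≤ K₀ * Real.exp (-(κ * ρd (loc b) (loc b')))) (k : Λ) :
    hC.eigenvalues k ≤ K₀ * (m * Kc κ) := by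
  obtain ⟨h2, h2t⟩ := WRS_zero_of_entrywise hKc hρs hK₀ hκ loc hfib hC216
  exact eigenvalues_le_of_form_le hC
    (fun v => (le_abs_self _).trans (abs_quadForm_le_of_WRS (weightHyp_loc hρ le_rfl loc) h2 h2t v)) k

end Eigen

/-- **`λ_max(C) ≤ K̄_C·𝒦.m·(1+2∕w.κ)^ν` FROM THE WALK RECORD**: the reference covariance of a record with walk objects
(`w` admissible at some `α ≥ 0`) has all eigenvalues below `w.K̄_C·(𝒦.m·(1+2∕w.κ)^ν)` — L17a's `hC216` at the
reference configuration (`localisation17a_of_termWalkData`) + §4's Rayleigh bound on the site torus.  Discharges the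
letter `hc` of T21∕T25∕T26∕T27 and of §2∕§3 above with `c_E := w.K̄_C·𝒦.m·(1+2∕w.κ)^ν`.
[cite: Balaban1988RG2Cluster, p.13, (2.16) p.16, (2.24) p.17; Balaban1985BackgroundPropagators, Thm 3.10 p.416] -/
theorem eigenvalues_le_of_termWalkData {𝒦 : TermKernels c d N' ν Nf B} {w : WalkConsts} {α Rσ₀ : ℝ}
    (hw : w.Admissible α Rσ₀) (hα : 0 ≤ α) (h : TermWalkData 𝒦 w) (k : 𝒦.Λ) :
    𝒦.hC.1.eigenvalues k ≤ w.KbarC * (𝒦.m * (1 + 2 / w.kap) ^ ν) :=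
  eigenvalues_le_of_located (weightHyp_tdist1 (N := Nf)) tdist1_symm kc_tdist1 𝒦.hC.1 hw.hKbarC hw.hkap 𝒦.locΛ
    𝒦.hfib (localisation17a_of_termWalkData hw hα h (mem_ball_self (hα.trans_lt hw.hαR))).hC216 k

/-- **`Re A(σ,u) ≻ 0` FROM THE RECORD AND SYMMETRY, NO SPECTRAL LETTER** (§2 with `c_E` from §4): record + admissible
package + symmetry of `A(σ,u)` + the single smallness `θ_E(w,α)·(𝒦.m(1+2∕w.κ)^ν)·(K̄_C·𝒦.m(1+2∕w.κ)^ν) < 1` in the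
record's letters ⟹ `Re A(σ,u) ≻ 0`. [cite: Balaban1988RG2Cluster, p.15, (2.16) p.16, (2.24) p.17] -/
theorem re_posDef_of_termWalkData' {𝒦 : TermKernels c d N' ν Nf B} {w : WalkConsts} {α Rσ₀ : ℝ}
    (hw : w.Admissible α Rσ₀) (hα : 0 ≤ α) (h : TermWalkData 𝒦 w) {u : B} (hu : ‖u‖ ≤ α)
    (σ : TPt d N' → ℂ) (hσ : ∀ j, ‖σ j‖ ≤ Real.exp c.κ₁) (hAs : (𝒦.A2 σ u).IsSymm)
    (hsmall : (2 * w.KbarE * Real.exp (-(w.ε * w.Rσ)) + 2 * w.KbarE * α / w.R)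
      * (𝒦.m * (1 + 2 / w.kap) ^ ν) * (w.KbarC * (𝒦.m * (1 + 2 / w.kap) ^ ν)) < 1) :
    ((𝒦.A2 σ u).map Complex.re).PosDef :=
  re_posDef_of_termWalkData hw hα h hu σ hσ hAs (eigenvalues_le_of_termWalkData hw hα h) hsmall

/-! ## §5. The Γ₀-form letter `g` from the record (`⟨Γ₀X, CΓ₀X⟩ ≤ g‖X‖²`) -/

section Schur

variable {S : Type*} [DecidableEq S] {ρd : S → S → ℝ} {Kc : ℝ → ℝ}
variable {p n : Type} [Fintype p] [Fintype n]

/-- **Schur bound for a located rectangular real kernel with entrywise decay**: `‖R_{ij}‖ ≤ θe^{−κρ(loc i, loc′ j)}`,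
`κ > 0`, at most `m` row indices and at most `m` column indices per site ⟹ `‖RX‖² ≤ (θ·m·Kc(κ))²·‖X‖²` — row and column
sums `≤ θ′ := θ·m·Kc(κ)` (`rowSum_norm_le_of_entrywise`, `colSum_norm_le_of_entrywise`), then the bilinear Schur test
`B13Replacement223.abs_bilinForm_le` on the normalised kernel `θ′⁻¹R` with `v = θ′⁻¹RX`, `w = X`.
[cite: Balaban1988RG2Cluster, (2.16) p.16, (2.21) p.16] -/
theorem mulVec_sq_le_of_located
    (hKc : ∀ b : ℝ, 0 < b → ∀ (T : Finset S) (x : S), ∑ y ∈ T, Real.exp (-(b * ρd x y)) ≤ Kc b)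
    (hρs : ∀ x y : S, ρd x y = ρd y x) {R : Matrix p n ℝ} {θ κ : ℝ} (hθ : 0 ≤ θ) (hκ : 0 < κ)
    (locp : p → S) (locn : n → S) {m : ℕ}
    (hfibp : ∀ x : S, (Finset.univ.filter fun i => locp i = x).card ≤ m)
    (hfibn : ∀ x : S, (Finset.univ.filter fun j => locn j = x).card ≤ m)
    (hR : ∀ i j, ‖R i j‖ ≤ θ * Real.exp (-(κ * ρd (locp i) (locn j)))) (X : n → ℝ) :
    (R *ᵥ X) ⬝ᵥ (R *ᵥ X) ≤ (θ * (m * Kc κ)) ^ 2 * (X ⬝ᵥ X) := by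
  set θ' : ℝ := θ * (m * Kc κ) with hθ'
  have hrow : ∀ i, ∑ j, |R i j| ≤ θ' := fun i => by
    simpa only [Real.norm_eq_abs] using rowSum_norm_le_of_entrywise hKc hθ hκ locp locn hfibn hR i
  have hcol : ∀ j, ∑ i, |R i j| ≤ θ' := fun j => by
    simpa only [Real.norm_eq_abs] using colSum_norm_le_of_entrywise hKc hρs hθ hκ locp locn hfibp hR j
  have hXX : 0 ≤ X ⬝ᵥ X := by
    simp only [dotProduct]; exact Finset.sum_nonneg fun i _ => mul_self_nonneg _
  rcases isEmpty_or_nonempty p with hp | hp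
  · -- no rows: the left-hand side is an empty sum
    have h0 : (R *ᵥ X) ⬝ᵥ (R *ᵥ X) = 0 := by simp [dotProduct]
    rw [h0]; exact mul_nonneg (sq_nonneg _) hXX
  obtain ⟨i₀⟩ := hp
  rcases eq_or_lt_of_le (show (0 : ℝ) ≤ θ' from
    (Finset.sum_nonneg fun j _ => abs_nonneg _).trans (hrow i₀)) with h0 | hpos
  · -- degenerate: all row sums vanish, so `R = 0`
    have hR0 : R = 0 := by
      ext i j
      have hs : ∑ j, |R i j| ≤ 0 := (hrow i).trans_eq h0.symm
      have hle : |R i j| ≤ ∑ j, |R i j| := Finset.single_le_sum (fun j _ => abs_nonneg (R i j)) (Finset.mem_univ j)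
      exact abs_nonpos_iff.1 (hle.trans hs)
    rw [hR0, Matrix.zero_mulVec, dotProduct_zero]
    exact mul_nonneg (sq_nonneg _) hXX
  · -- normalise: `R′ = θ′⁻¹R` has row and column sums ≤ 1
    set R' : Matrix p n ℝ := θ'⁻¹ • R with hR'
    have hrow' : ∀ i, ∑ j, |R' i j| ≤ 1 := fun i => by
      have : ∑ j, |R' i j| = θ'⁻¹ * ∑ j, |R i j| := by
        rw [Finset.mul_sum]; exact Finset.sum_congr rfl fun j _ => by
          rw [hR', Matrix.smul_apply, smul_eq_mul, abs_mul, abs_of_pos (inv_pos.2 hpos)]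
      rw [this]; exact (mul_le_mul_of_nonneg_left (hrow i) (inv_pos.2 hpos).le).trans_eq (inv_mul_cancel₀ hpos.ne')
    have hcol' : ∀ j, ∑ i, |R' i j| ≤ 1 := fun j => by
      have : ∑ i, |R' i j| = θ'⁻¹ * ∑ i, |R i j| := by
        rw [Finset.mul_sum]; exact Finset.sum_congr rfl fun i _ => by
          rw [hR', Matrix.smul_apply, smul_eq_mul, abs_mul, abs_of_pos (inv_pos.2 hpos)]
      rw [this]; exact (mul_le_mul_of_nonneg_left (hcol j) (inv_pos.2 hpos).le).trans_eq (inv_mul_cancel₀ hpos.ne')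
    -- Schur test with `v = R′X`, `w = X`: `‖R′X‖² ≤ ½(‖R′X‖² + ‖X‖²)`
    have hb := abs_bilinForm_le R' (R' *ᵥ X) X hrow' hcol'
    have hY : (R' *ᵥ X) ⬝ᵥ (R' *ᵥ X) ≤ X ⬝ᵥ X := by
      have := (le_abs_self _).trans hb
      linarith
    have hRX : R *ᵥ X = θ' • (R' *ᵥ X) := by
      rw [hR', Matrix.smul_mulVec, smul_smul, mul_inv_cancel₀ hpos.ne', one_smul]
    rw [hRX, smul_dotProduct, dotProduct_smul, smul_eq_mul, smul_eq_mul, ← mul_assoc, ← pow_two]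
    exact mul_le_mul_of_nonneg_left hY (sq_nonneg _)

end Schur

/-- **THE Γ₀-FORM LETTER `g` FROM THE WALK RECORD**: with a common fibre bound `m` for rows (`𝒦.m ≤ m`) and columns
(`hfibN`, located typing point (x10)), `⟨Γ₀X, C Γ₀X⟩ ≤ g·‖X‖²` with
`g := (K̄_C·𝒦.m·(1+2∕w.κ)^ν)·(K̄_Γ·m·(1+2∕w.κ)^ν)²` — §4's spectral bound for `C` and §5's Schur bound for `Γ₀` (L17a's
`hΓ₀`).  Discharges the letters `g`, `hg`, `hΓq` of T21∕T25∕T26∕T27 from the record.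
[cite: Balaban1988RG2Cluster, p.13, (2.16) p.16, (2.24)–(2.25) p.17] -/
theorem gammaForm_le_of_termWalkData {𝒦 : TermKernels c d N' ν Nf B} [Fintype 𝒦.C₀] {w : WalkConsts} {α Rσ₀ : ℝ}
    (hw : w.Admissible α Rσ₀) (hα : 0 ≤ α) (h : TermWalkData 𝒦 w) {m : ℕ} (hm : 𝒦.m ≤ m)
    (hfibN : ∀ x : UT Nf, (Finset.univ.filter fun j => 𝒦.locN j = x).card ≤ m) (X : 𝒦.Λ ⊕ 𝒦.C₀ → ℝ) :
    (𝒦.Γ₀ *ᵥ X) ⬝ᵥ (𝒦.C *ᵥ (𝒦.Γ₀ *ᵥ X)) ≤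
      (w.KbarC * (𝒦.m * (1 + 2 / w.kap) ^ ν)) * (w.KbarΓ * (m * (1 + 2 / w.kap) ^ ν)) ^ 2 * (X ⬝ᵥ X) := by
  have h17 := localisation17a_of_termWalkData hw hα h (mem_ball_self (hα.trans_lt hw.hαR))
  have hfibΛ : ∀ x : UT Nf, (Finset.univ.filter fun i => 𝒦.locΛ i = x).card ≤ m := fun x => (𝒦.hfib x).trans hm
  have h1 := quadForm_le 𝒦.hC (eigenvalues_le_of_termWalkData hw hα h) (𝒦.Γ₀ *ᵥ X)
  have h2 := mulVec_sq_le_of_located kc_tdist1 tdist1_symm hw.hKbarΓ hw.hkap 𝒦.locΛ 𝒦.locN hfibΛ hfibN h17.hΓ₀ X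
  have hc0 : 0 ≤ w.KbarC * (𝒦.m * (1 + 2 / w.kap) ^ ν) := by
    have := hw.hKbarC; have := hw.hkap; positivity
  rw [mul_assoc]
  exact h1.trans (mul_le_mul_of_nonneg_left h2 hc0)

end Summit.QuantumFields.BalabanUV.T4Continuum.Spine.NE5.TwoRunTorusWalkRePos

end
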